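import Summits.QuantumAdvantage.QuantumAdvantage.Theorems.LinnikCubicClassGroupsDegreeOnePrimesEscapeClassPNTDHSmoothed
import Summits.QuantumAdvantage.QuantumAdvantage.Theorems.LinnikCubicClassGroupsDegreeOnePrimesEscapeClassPNTTheta
import HarnessLib

/-!
# The class prime number theorem with the Deuring–Heilbronn phenomenon, IV: the `θ_C`-form

Topic `Summits/QuantumAdvantage/QuantumAdvantage/Theorems`, cell B2b-1 (linnik-cubic), PART A (gen 4);
helper toward the crux `DegreeOnePrimesEscape` (stmt-QuantumAdvantage-11543) of route
`LinnikCubicClassGroups`.  HONEST FRAMING: the value of this file is a THEOREM (kernel-checked,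
GRH-free) — NOT summit progress (the route still rests on the hypothesis-type target
`PureCubicClassNumberHard`).

`thetaClass_dichotomy_dh`: the Deuring–Heilbronn sharpening of `thetaClass_dichotomy` (`…ClassPNTTheta.lean`).
GIVEN the Deuring–Heilbronn phenomenon for the class group `L`-functions (hypothesis `hDH`, the statement of
`Literature.NumberTheory.LFunctions.NumberField.deuringHeilbronn` verbatim), for the number fields `K` of one
degree `n > 1` obeying the family density bound in `Q`-form and every `η > 0`: EITHER
`|θ_C(x) − x/h| ≤ η x/h` for all `x ≥ Q^{a₂}` and all classes `C`; OR there is a real class group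
character `χ₁` with a real zero `β₁ ∈ (1 − c/(log|d_K| + log 4), 1)` of `L(s, χ₁)` (`ζ_K` if `χ₁ = 1`) and

  `|θ_C(x) − (x − χ₁(C) x^{β₁}/β₁)/h| ≤ η · x · min(1, (1 − β₁) log x) / h`   for all `x ≥ Q^{a₂}`, all `C`.

Unsmoothing is class by class with trivial short-interval bounds (`abs_theta_sub_smoothedPsiClass_le`); the
unsmoothing and main-term errors are `O(x^{1−ν} log x · h_K)` and are absorbed into
`η x · c₁(n) Q^{−2} ≤ η x · min(1, (1 − β₁) log x)` by Stark's effective bound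
(`Residue.one_sub_realZero_ge_condQn_rpow`).

References: J. Thorner, A. Zaman, Algebra Number Theory 13 (2019), Thm. 1.4 [ThornerZaman2019];
A. Weiss, J. reine angew. Math. 338 (1983), Thm. 5.2 [Weiss1983].
-/

noncomputable section

open Complex Real MeasureTheory Set Filter Topology
open scoped NumberField nonZeroDivisors

namespace Summit.QuantumAdvantage.QuantumAdvantage.Theorems.DegreeOnePrimesEscape

open Literature.NumberTheory.LFunctions Literature.NumberTheory.LFunctions.NumberField
  Literature.NumberTheory.LFunctions.EntireEF Literature.NumberTheory.LFunctions.TZWeight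
  Literature.NumberTheory.LFunctions.AbelianDensity

set_option maxHeartbeats 1600000 in
/-- **The `θ_C`-form of the class prime number theorem dichotomy with the Deuring–Heilbronn phenomenon**
(see the module docstring). [cite: ThornerZaman2019, Theorem 1.4] [cite: Weiss1983, Theorem 5.2] -/
theorem thetaClass_dichotomy_dh (n : ℕ) (hn : 1 < n) {b D a : ℝ} (hb : 0 < b) (hD : 0 < D) (ha : 1 ≤ a)
    {η : ℝ} (hη : 0 < η)
    (hDH : ∃ C : ℝ, 0 < C ∧ ∀ (K : Type) [Field K] [NumberField K] (χ₁ : ClassGroup (𝓞 K) →* ℂˣ),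
      χ₁ * χ₁ = 1 → ∀ β₁ : ℝ, 0 < β₁ → β₁ < 1 → classGroupLFunction K χ₁ β₁ = 0 →
      ∀ (χ : ClassGroup (𝓞 K) →* ℂˣ) (ρ : ℂ), classGroupLFunction K χ ρ = 0 → 1 / 2 ≤ ρ.re → ρ ≠ 1 →
        ρ ≠ β₁ →
        Real.log (1 / (C * (Real.log ((NumberField.discr K).natAbs : ℝ) +
            Module.finrank ℚ K * (Real.log (|ρ.im| + 2) + 1)) * (1 - β₁))) /
          (C * (Real.log ((NumberField.discr K).natAbs : ℝ) +
            Module.finrank ℚ K * (Real.log (|ρ.im| + 2) + 1))) ≤ 1 - ρ.re) :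
    ∃ a₂ c : ℝ, 1 ≤ a₂ ∧ 0 < c ∧ c ≤ 1 / (8 * ((n : ℝ) ^ 2 + 1)) ∧
    ∀ (K : Type) [Field K] [NumberField K], Module.finrank ℚ K = n →
      (∀ (T : ℝ), 1 ≤ T → ∀ u : AddChar (Additive (ClassGroup (𝓞 K))) ℂ → Finset ℂ,
        (∀ ψ, ∀ ρ ∈ u ψ, famF K ψ ρ = 0 ∧ 1 / 4 ≤ ρ.re ∧ ρ.re < 1 ∧ |ρ.im| ≤ T) →
        ∀ α : ℝ, α ≤ 1 →
          ∑ ψ, ∑ ρ ∈ u ψ with α ≤ ρ.re, (famMult K ψ ρ : ℝ) ≤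
            D * Real.exp (b * (a * Real.log (ThornerZaman.condQn K) + Real.log (T + 4))) ^ (1 - α)) →
      (∀ x : ℝ, ThornerZaman.condQn K ^ a₂ ≤ x → ∀ C : ClassGroup (𝓞 K),
          |chebyshevThetaIdealClass K C x - x / NumberField.classNumber K| ≤
            η * x / NumberField.classNumber K) ∨
      ∃ (χ₁ : ClassGroup (𝓞 K) →* ℂˣ) (β₁ : ℝ), χ₁ * χ₁ = 1 ∧
          1 - c / (Real.log ((NumberField.discr K).natAbs : ℝ) + Real.log 4) < β₁ ∧ β₁ < 1 ∧
          classGroupLFunction K χ₁ β₁ = 0 ∧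
          ∀ x : ℝ, ThornerZaman.condQn K ^ a₂ ≤ x → ∀ C : ClassGroup (𝓞 K),
            |chebyshevThetaIdealClass K C x -
                (x - ((χ₁ C : ℂ)).re * x ^ β₁ / β₁) / NumberField.classNumber K| ≤
              η * x * min 1 ((1 - β₁) * Real.log x) / NumberField.classNumber K := by
  classical
  have hη4 : 0 < η / 4 := by positivity
  obtain ⟨ν, a₁, c, hν0, hν64, ha₁1, hc, hcn, hmain⟩ := smoothedClassSum_dichotomy_dh n hn hb hD ha hη4 hDH
  obtain ⟨c₁, hc₁, hc₁1, heff⟩ := Residue.one_sub_realZero_ge_condQn_rpow n hn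
  -- thresholds: unsmoothing (`unsmoothing_small` with `(η/4) c₁ Q^{-2}` and `n h`, `h ≤ Q⁴`) and the main
  -- terms (`√x, x^{1-ν} ≤ (η c₁/64) x Q^{-2}`)
  set Λu : ℝ := max 0 (Real.log (176 * ((n : ℝ) + 1) / (ν * η * c₁))) with hΛu
  have hΛu0 : 0 ≤ Λu := le_max_left _ _
  set Λm : ℝ := max 0 (Real.log (64 / (η * c₁))) with hΛm
  have hΛm0 : 0 ≤ Λm := le_max_left _ _
  set a₂ : ℝ := max a₁ (max (2 * (Λu + 6) / ν) ((2 + Λm) / ν)) with ha₂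
  have ha₂a₁ : a₁ ≤ a₂ := le_max_left _ _
  have ha₂u : 2 * (Λu + 6) / ν ≤ a₂ := le_trans (le_max_left _ _) (le_max_right _ _)
  have ha₂m : (2 + Λm) / ν ≤ a₂ := le_trans (le_max_right _ _) (le_max_right _ _)
  have ha₂1 : 1 ≤ a₂ := le_trans ha₁1 ha₂a₁
  refine ⟨a₂, c, ha₂1, hc, hcn, fun K _ _ hKn hdens ↦ ?_⟩
  have hK : 1 < Module.finrank ℚ K := by rw [hKn]; exact hn
  set Q : ℝ := ThornerZaman.condQn K with hQ
  have hQ12 : (12 : ℝ) ≤ Q := ThornerZaman.twelve_le_condQn (K := K) hK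
  have hQ1 : (1 : ℝ) < Q := by linarith
  have hQ0 : (0 : ℝ) < Q := by linarith
  have hlogQ : 2 ≤ Real.log Q := two_lt_log_twelve.le.trans (Real.log_le_log (by norm_num) hQ12)
  have hlogQ1 : 1 ≤ Real.log Q := by linarith
  set h : ℝ := (NumberField.classNumber K : ℝ) with hh
  have hh1 : 1 ≤ h := by rw [hh]; exact_mod_cast one_le_classNumber (K := K)
  have hh0 : 0 < h := by linarith
  have hhQ : h ≤ Q ^ 4 := by
    have := ThornerZaman.classNumber_le_condQn_pow (K := K) hK; rw [← hQ] at this; exact this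
  have hQm2 : Q ^ (-(2 : ℝ)) ≤ 1 := Real.rpow_le_one_of_one_le_of_nonpos hQ1.le (by norm_num)
  have hQm2' : 0 < Q ^ (-(2 : ℝ)) := Real.rpow_pos_of_pos hQ0 _
  set m' : ℝ := c₁ * Q ^ (-(2 : ℝ)) with hm'
  have hm'0 : 0 < m' := mul_pos hc₁ hQm2'
  have hm'1 : m' ≤ 1 := (mul_le_mul hc₁1 hQm2 hQm2'.le zero_le_one).trans (by norm_num)
  have hQne : Q ≠ 0 := hQ0.ne'
  have hm'2 : m' = c₁ * (Q ^ 2)⁻¹ := by rw [hm', Real.rpow_neg hQ0.le, Real.rpow_two]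
  -- common estimates at `x ≥ Q^{a₂}`
  have hcommon : ∀ x : ℝ, Q ^ a₂ ≤ x → Q ^ a₁ ≤ x ∧ 1 < x ∧
      (∀ C : ClassGroup (𝓞 K), h * |chebyshevThetaIdealClass K C x -
          smoothedPsiClass K C (tzTest (Real.log x) (x ^ (-ν)))| ≤ η / 4 * x * m') ∧
      Real.sqrt x ≤ η / 64 * x * m' ∧ x ^ (-ν) * x ≤ η / 64 * x * m' ∧
      0 < x ^ (-ν) ∧ x ^ (-ν) ≤ 1 ∧ x ^ (-ν) < Real.log x / 2 ∧ 1 ≤ Real.log x := by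
    intro x hx
    have hxa₁ : Q ^ a₁ ≤ x := le_trans (Real.rpow_le_rpow_of_exponent_le hQ1.le ha₂a₁) hx
    have hxQ : Q ≤ x := by
      have : Q ^ (1 : ℝ) ≤ Q ^ a₂ := Real.rpow_le_rpow_of_exponent_le hQ1.le ha₂1
      rw [Real.rpow_one] at this; linarith
    have hx1 : 1 < x := by linarith
    have hx0 : 0 < x := by linarith
    set L : ℝ := Real.log x with hL
    have hLQ : a₂ * Real.log Q ≤ L := by
      have := Real.log_le_log (by positivity) hx
      rwa [Real.log_rpow (by linarith)] at this
    have hL2a : 2 * a₂ ≤ L := by nlinarith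
    have hL2 : 2 ≤ L := by linarith
    have hL0 : 0 < L := by linarith
    have hexpL : Real.exp L = x := by rw [hL, Real.exp_log hx0]
    set ε : ℝ := x ^ (-ν) with hε
    have hε0 : 0 < ε := Real.rpow_pos_of_pos hx0 _
    have hε1 : ε ≤ 1 := Real.rpow_le_one_of_one_le_of_nonpos hx1.le (by linarith)
    have hε1' : ε < 1 := Real.rpow_lt_one_of_one_lt_of_neg hx1 (by linarith)
    have hεL : ε < L / 2 := by linarith
    -- unsmoothing, with `η' = (η/4) m'`
    have hxe : Real.exp 1 ≤ x := by rw [← hexpL]; exact Real.exp_le_exp.2 (by linarith)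
    have hU : ∀ C : ClassGroup (𝓞 K), h * |chebyshevThetaIdealClass K C x -
        smoothedPsiClass K C (tzTest L ε)| ≤ η / 4 * x * m' := by
      intro C
      have h1 := abs_theta_sub_smoothedPsiClass_le C hx1 hε0 hε1
      rw [hKn] at h1
      have hlarge : 2 / ν * Real.log (44 * ((n : ℝ) * h + 1) / (ν * (η / 4 * m'))) ≤ L := by
        -- `44 (n h + 1)/(ν (η/4) m') ≤ (176 (n+1)/(ν η c₁)) Q⁶`
        have hcmp : 44 * ((n : ℝ) * h + 1) / (ν * (η / 4 * m')) ≤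
            (176 * ((n : ℝ) + 1) / (ν * η * c₁)) * Q ^ 6 := by
          rw [hm'2, div_le_iff₀ (by positivity)]
          have hQ4 : 1 ≤ Q ^ 4 := one_le_pow₀ hQ1.le
          have hn0 : (0 : ℝ) ≤ n := Nat.cast_nonneg _
          have hnh : (n : ℝ) * h + 1 ≤ ((n : ℝ) + 1) * Q ^ 4 := by
            nlinarith [mul_le_mul_of_nonneg_left hhQ hn0]
          have e : 176 * ((n : ℝ) + 1) / (ν * η * c₁) * Q ^ 6 * (ν * (η / 4 * (c₁ * (Q ^ 2)⁻¹))) =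
              44 * (((n : ℝ) + 1) * Q ^ 4) := by
            field_simp; ring
          rw [e]; nlinarith
        have hlogle : Real.log (44 * ((n : ℝ) * h + 1) / (ν * (η / 4 * m'))) ≤ Λu + 6 * Real.log Q := by
          refine (Real.log_le_log (by positivity) hcmp).trans ?_
          rw [Real.log_mul (by positivity) (by positivity), Real.log_pow]
          push_cast
          linarith [le_max_right 0 (Real.log (176 * ((n : ℝ) + 1) / (ν * η * c₁)))]
        have h2ν : 0 < 2 / ν := by positivity
        calc 2 / ν * Real.log (44 * ((n : ℝ) * h + 1) / (ν * (η / 4 * m')))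
            ≤ 2 / ν * (Λu + 6 * Real.log Q) := mul_le_mul_of_nonneg_left hlogle h2ν.le
          _ ≤ 2 / ν * ((Λu + 6) * Real.log Q) := by
              refine mul_le_mul_of_nonneg_left ?_ h2ν.le
              nlinarith
          _ = 2 * (Λu + 6) / ν * Real.log Q := by ring
          _ ≤ a₂ * Real.log Q := mul_le_mul_of_nonneg_right ha₂u (by linarith)
          _ ≤ L := hLQ
      have hsmall := unsmoothing_small (n := (n : ℝ) * h) (ν := ν) (η := η / 4 * m') (t := x)
        (by positivity) hν0 (by linarith) (by positivity) hxe hlarge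
      have e1 : (n : ℝ) * h * ((Real.log x + 1) * (8 * Real.sqrt x + 2 * x ^ (-ν) * x + 1)) =
          h * ((n : ℝ) * ((Real.log x + 1) * (8 * Real.sqrt x + 2 * ε * x + 1))) := by rw [hε]; ring
      rw [e1] at hsmall
      have := mul_le_mul_of_nonneg_left h1 hh0.le
      linarith
    -- the main-term errors: `x^{-ν} ≤ (η c₁/64) Q^{-2}`, hence `√x, εx ≤ (η/64) x m'`
    have hth := mul_rpow_neg_le_one_of_threshold (k := 2) (M := 64 / (η * c₁)) hQ12 hx hν0
      (by positivity) (by rw [← hΛm]; have := (div_le_iff₀ hν0).1 ha₂m; linarith)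
    have hεm : ε ≤ η / 64 * m' := by
      rw [Real.rpow_two] at hth
      rw [hm'2, hε]
      have hMQ : 0 < 64 / (η * c₁) * Q ^ 2 := by positivity
      have h1 : x ^ (-ν) ≤ 1 / (64 / (η * c₁) * Q ^ 2) := by
        rw [le_div_iff₀ hMQ, mul_comm]; exact hth
      have h2 : 1 / (64 / (η * c₁) * Q ^ 2) = η / 64 * (c₁ * (Q ^ 2)⁻¹) := by
        field_simp
      rw [← h2]; exact h1
    have hεx : ε * x ≤ η / 64 * x * m' := by
      have := mul_le_mul_of_nonneg_right hεm hx0.le; linarith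
    have hsqrt : Real.sqrt x ≤ η / 64 * x * m' := by
      have h1 : Real.sqrt x = x ^ (-(1 / 2 : ℝ)) * x := by
        rw [Real.sqrt_eq_rpow, show (-(1 / 2 : ℝ)) = 1 / 2 - 1 by norm_num, Real.rpow_sub hx0,
          Real.rpow_one]
        field_simp
      have h2 : x ^ (-(1 / 2 : ℝ)) ≤ ε := Real.rpow_le_rpow_of_exponent_le hx1.le (by linarith)
      rw [h1]
      have := mul_le_mul_of_nonneg_right (h2.trans hεm) hx0.le
      linarith
    exact ⟨hxa₁, hx1, hU, hsqrt, hεx, hε0, hε1, hεL, by linarith⟩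
  rcases hmain K hKn hdens with hgood | ⟨ψ₁, β₁, hz, hβlow, hβ1, hreal, hexc⟩
  · -- no exceptional zero
    left
    intro x hx C
    obtain ⟨hxa₁, hx1, hU, hsqrt, hεx, hε0, hε1, hεL, -⟩ := hcommon x hx
    have hx0 : 0 < x := by linarith
    have h1 := hgood x hxa₁ C
    have h1' := (Complex.abs_re_le_norm _).trans h1
    simp only [Complex.sub_re, Complex.mul_re, Complex.natCast_re, Complex.natCast_im,
      Complex.ofReal_re, Complex.ofReal_im, mul_zero, sub_zero] at h1'
    have h2 := abs_re_fordLaplace_tzTest_neg_one_sub_le hx1 hε0 hε1 hεL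
    have h3 := hU C
    have hm'x : η / 4 * x * m' ≤ η / 4 * x := by
      have := mul_le_mul_of_nonneg_left hm'1 (by positivity : (0 : ℝ) ≤ η / 4 * x); linarith
    have hm'x' : η / 64 * x * m' ≤ η / 64 * x := by
      have := mul_le_mul_of_nonneg_left hm'1 (by positivity : (0 : ℝ) ≤ η / 64 * x); linarith
    have hkey : |h * chebyshevThetaIdealClass K C x - x| ≤ η * x := by
      have hD : |h * (chebyshevThetaIdealClass K C x -
          smoothedPsiClass K C (tzTest (Real.log x) (x ^ (-ν))))| ≤ η / 4 * x := by
        rw [abs_mul, abs_of_pos hh0]; exact (h3.trans hm'x)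
      have hD' := abs_le.1 hD
      rw [abs_le] at h1' h2 ⊢
      rw [← hh] at h1'
      have hηx : 0 < η * x := mul_pos hη hx0
      constructor <;> linarith [hD'.1, hD'.2, h1'.1, h1'.2, h2.1, h2.2, hsqrt, hεx]
    have e : chebyshevThetaIdealClass K C x - x / h = (h * chebyshevThetaIdealClass K C x - x) / h := by
      field_simp
    rw [e, abs_div, abs_of_pos hh0, div_le_div_iff_of_pos_right hh0]
    exact hkey
  · -- the exceptional zero
    right
    set χ₁ : ClassGroup (𝓞 K) →* ℂˣ := (toMulHom ψ₁).toHomUnits with hχ₁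
    have hβ1ne : ((β₁ : ℝ) : ℂ) ≠ 1 := by
      intro h'; apply hβ1.ne; exact_mod_cast h'
    have hLzero : classGroupLFunction K χ₁ β₁ = 0 := classGroupLFunction_eq_zero_of_famF ψ₁ hz hβ1ne
    have hδlow : m' ≤ 1 - β₁ := heff K hKn χ₁ hreal β₁ hβ1 hLzero
    -- `β₁ ≥ 1/2`
    have hβhalf : 1 / 2 ≤ β₁ := by
      have hlog4 : 1 < Real.log 4 := by
        rw [show (4:ℝ) = 2 ^ 2 by norm_num, Real.log_pow]; have := Real.log_two_gt_d9; push_cast; linarith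
      have hlogd : 0 ≤ Real.log ((NumberField.discr K).natAbs : ℝ) := Real.log_natCast_nonneg _
      have hc2 : c ≤ 1 / 2 :=
        hcn.trans (by rw [div_le_div_iff_of_pos_left one_pos (by positivity) (by norm_num)]; nlinarith)
      have : c / (Real.log ((NumberField.discr K).natAbs : ℝ) + Real.log 4) ≤ 1 / 2 := by
        rw [div_le_iff₀ (by linarith)]; nlinarith
      linarith
    refine ⟨χ₁, β₁, hreal, hβlow, hβ1, hLzero, fun x hx C ↦ ?_⟩
    obtain ⟨hxa₁, hx1, hU, hsqrt, hεx, hε0, hε1, hεL, hL1⟩ := hcommon x hx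
    have hx0 : 0 < x := by linarith
    -- `m' ≤ m = min 1 ((1 - β₁) log x)`
    set m : ℝ := min 1 ((1 - β₁) * Real.log x) with hmdef
    have hδm : 1 - β₁ ≤ (1 - β₁) * Real.log x := by
      have := mul_le_mul_of_nonneg_left hL1 (by linarith : (0 : ℝ) ≤ 1 - β₁); linarith
    have hm'm : m' ≤ m := le_min hm'1 (hδlow.trans hδm)
    have hm0 : 0 ≤ m := hm'0.le.trans hm'm
    have h1 := hexc x hxa₁ C
    have h1' := (Complex.abs_re_le_norm _).trans h1
    have hFreal : (fordLaplace (tzTest (Real.log x) (x ^ (-ν))) (-(β₁ : ℂ))).im = 0 := by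
      rw [fordLaplace_tzTest_ofReal (Real.log_pos hx1) hε0 β₁, Complex.ofReal_im]
    have hψC : ψ₁ (Additive.ofMul C⁻¹) = (χ₁ C : ℂ) := by
      rw [← classGroupChar_apply_inv_of_real hreal C]
      exact (toHomUnits_toMulHom_apply ψ₁ C⁻¹).symm
    simp only [Complex.add_re, Complex.sub_re, Complex.mul_re, Complex.natCast_re, Complex.natCast_im,
      Complex.ofReal_re, Complex.ofReal_im, mul_zero, sub_zero, hFreal, hψC] at h1'
    have h2 := abs_re_fordLaplace_tzTest_neg_one_sub_le hx1 hε0 hε1 hεL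
    have h4 := abs_re_fordLaplace_tzTest_neg_sub_le hx1 hε0 hε1 hεL hβhalf hβ1.le
    have h3 := hU C
    have hχre := abs_re_classGroupChar_apply_le hreal C
    -- scale the junk bounds from `m'` to `m`
    have h3m : h * |chebyshevThetaIdealClass K C x -
        smoothedPsiClass K C (tzTest (Real.log x) (x ^ (-ν)))| ≤ η / 4 * x * m :=
      h3.trans (mul_le_mul_of_nonneg_left hm'm (by positivity))
    have hsqrtm : Real.sqrt x ≤ η / 64 * x * m := hsqrt.trans (mul_le_mul_of_nonneg_left hm'm (by positivity))
    have hεxm : x ^ (-ν) * x ≤ η / 64 * x * m := hεx.trans (mul_le_mul_of_nonneg_left hm'm (by positivity))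
    set mt : ℝ := x ^ β₁ / β₁ with hmtdef
    have hkey : |h * chebyshevThetaIdealClass K C x - (x - ((χ₁ C : ℂ)).re * mt)| ≤ η * x * m := by
      have hD : |h * (chebyshevThetaIdealClass K C x -
          smoothedPsiClass K C (tzTest (Real.log x) (x ^ (-ν))))| ≤ η / 4 * x * m := by
        rw [abs_mul, abs_of_pos hh0]; exact h3m
      have hD' := abs_le.1 hD
      rw [← hh] at h1'
      set r : ℝ := ((χ₁ C : ℂ)).re with hr
      set Fβ : ℝ := (fordLaplace (tzTest (Real.log x) (x ^ (-ν))) (-(β₁ : ℂ))).re with hFβ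
      have hprod : |r * Fβ - r * mt| ≤ 2 * Real.sqrt x + 4 * x ^ (-ν) * x := by
        rw [← mul_sub, abs_mul]
        calc |r| * |Fβ - mt| ≤ 1 * (2 * Real.sqrt x + 4 * x ^ (-ν) * x) :=
              mul_le_mul hχre h4 (abs_nonneg _) zero_le_one
          _ = _ := one_mul _
      have hprod' := abs_le.1 hprod
      rw [abs_le] at h1' h2 ⊢
      have hηxm : 0 ≤ η * x * m := by positivity
      constructor <;> linarith [hD'.1, hD'.2, h1'.1, h1'.2, h2.1, h2.2, hprod'.1, hprod'.2, hsqrtm, hεxm]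
    rw [hmtdef] at hkey
    rw [mul_div_assoc]
    have e : chebyshevThetaIdealClass K C x - (x - ((χ₁ C : ℂ)).re * (x ^ β₁ / β₁)) / h =
        (h * chebyshevThetaIdealClass K C x - (x - ((χ₁ C : ℂ)).re * (x ^ β₁ / β₁))) / h := by
      field_simp
    rw [e, abs_div, abs_of_pos hh0, div_le_div_iff_of_pos_right hh0]
    exact hkey

end Summit.QuantumAdvantage.QuantumAdvantage.Theorems.DegreeOnePrimesEscape

end
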